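import Literature.NumberTheory.EllipticCurves.Sprung2012.HondaOrbitIndependenceProofs
import Mathlib.LinearAlgebra.Dual.Lemmas
import HarnessLib

/-!
# Sprung 2012 Thm. 2.2 / Cor. 2.10 / Lemma 2.3: the joint Coleman map `(Col♯, Col♭)` has cokernel `Λ/(T)` modulo ONE
# surjection `E(ℚ_{p,2}) ↠ ℤ_p^{p²}` — the Honda GENERATION clauses turn rank into the rank clause (proofs only)

Topic `Literature/NumberTheory/EllipticCurves`, cluster `Sprung2012` (namespace = path). A THEOREMS file (no definition, no named
fact; net Literature debt `0`). Cell `bsd-ssimc`, width seat `cruxlead-stmt-BirchSwinnertonDyer-19875-w2` (gen 8), `--supports`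
stmt-BirchSwinnertonDyer-22569 (item (α) of the F-α discharge list of the x8 cruxes `KatoFineLowerSporadicX8` / `CyclotomicLowerPosLevelX8`).
F. E. I. Sprung, *Iwasawa theory for elliptic curves at supersingular primes: A pair of main conjectures*, J. Number Theory **132**
(2012) [Sprung2012]. The chain `ColemanMapLevelCongruenceProofs` → `ColemanMapJointCokernelProofs` → `ColemanMapJointLinearProofs`
→ `HondaOrbitCongruenceProofs` → `HondaOrbitIndependenceProofs` proved the exact sequence (SES-KP) `0 → H¹_Iw(T) → Λ² → ℤ_p → 0`
in the tree's functional model over `ℚ` at an odd supersingular prime modulo the rank clause (RANK₂) «no `p² − 1` points of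
`E(ℚ_{p,2})` contain the Honda orbit in their span mod `p`» (dual form). THIS FILE derives (RANK₂) from the dual GENERATION clauses
of the tree's `IsHondaSystem` (Thm. 2.2 / Cor. 2.10: «`c_n, c_{n−1}` generate `Ê(𝔪_n)` over `ℤ_p[G_n]`», transcribed as: the pairing
vector `(P_{n,c_n}, P_{n,c_{n−1}})` is injective on layer functionals with `p`-saturated image) and ONE purely structural input:
**a surjective additive map `π : E(ℚ_p·ℚ_2) ↠ ℤ_p^{p²}`** («`E(ℚ_{p,2})` has `ℤ_p`-rank at least `p² = [ℚ_{p,2} : ℚ_p]`» — the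
formal group `Ê(ℚ_{p,2})`, of finite prime-to-`p` index, is `ℤ_p`-free of rank `p²`: Silverman AEC IV.6.4 / VII.6.3, Lutz;
Sprung Lemma 2.3 for torsion-freeness).

* `exists_addMonoidHom_dvd_and_not_dvd_of_surjective` — ABSTRACT: `π : L ↠ ℤ_p^d`, an orbit that GENERATES the functionals
  mod `p` (a functional divisible by `p` on the orbit is `p·w'`), and `m < d` points ⟹ a functional `≡ 0 (mod p)` on the points
  and `≢ 0` on the orbit (linear algebra over `𝔽_p`: `Submodule.exists_dual_map_eq_bot_of_lt_top`, lifted through `π`).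
* `exists_eq_mul_of_dvd_evalOn_orbit` — GENERATION at level `n ≥ 1` from `IsHondaSystem`: `w ≡ 0 (mod p)` on `{gʲc_n}`,
  `{gʲc_{n−1}}` ⟹ `w = p·w'` (pairing sums `= p·(A, B)`; saturation gives `y`; injectivity kills `w − p·y`).
* `honda_rank_of_surjective` — (RANK₂) from `π` and generation; `forall_exists_isColemanPair_X_mul_of_surjective` (any base);
  **`exists_linearMap_isColemanPair_cokernel_of_surjective_rat`** — over `ℚ`, `p ≠ 2` good supersingular, GIVEN `π`: an injective
  `Λ`-linear `J : H¹_Iw(T) → Λ × Λ` with `Col(z) = J z`, `T·Λ² ⊆ range J`, `ℓ_𝔭(Λ²/range J) = 0` at every prime `𝔭 ∌ T`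
  (= `J`/`hJ`/`hcoker` of the Summits skeleton `min_lengthAt_quotient_range_le_lengthAt_torsion_of_skeleton`).
HONEST FRAMING: the surjection `π` is the one residual input of item (α) — a textbook structural fact about `E` over the finite
extension `ℚ_{p,2}/ℚ_p`, absent from the tree (whose `IsHondaSystem` encodes generation but never rank); TRUE for every curve.
Nothing about any Selmer group, main conjecture or BSD is asserted here.

References: [Sprung2012] Thm. 2.2, Lemma 2.3 (p. 1487), Cor. 2.10 (p. 1489), Def. 3.1 (p. 1489), Def. 5.9 (p. 1495), Def. 7.1–7.2,
Props. 7.3/7.6, Lemmas 7.4–7.5 (pp. 1500–1501); [KuriharaPollack2007] Prop. 1.2; [LeiSujatha2021] §3 (SES-KP); [Silverman2009] AEC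
IV.6.4, VII.6.3; tree `Sprung2012/{ColemanMaps, ColemanTwistProofs (pairingSum_sub), ColemanMapLambdaActionProofs (pairingSum_smul),
HondaOrbitIndependenceProofs, ColemanMapJointLinearProofs}.lean`, Mathlib `LinearAlgebra/Dual/Lemmas`.
-/

noncomputable section

open scoped Classical

open Polynomial Finset

namespace Literature.NumberTheory.EllipticCurves.Sprung2012

/-! ## §1 Abstract: functionals separating `m < d` points from an orbit, from a surjection onto `ℤ_p^d` and «generation» -/

section Abstract

variable {p : ℕ} [Fact p.Prime] {L : Type*} [AddCommGroup L]

/-- `p ∣ x ↔ toZMod x = 0` in `ℤ_p`. [folklore] -/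
private theorem padicInt_dvd_iff_toZMod_eq_zero (x : ℤ_[p]) : (p : ℤ_[p]) ∣ x ↔ PadicInt.toZMod x = 0 := by
  rw [← RingHom.mem_ker, PadicInt.ker_toZMod, PadicInt.maximalIdeal_eq_span_p, Ideal.mem_span_singleton]

/-- **The rank clause from a surjection and generation.** `L` an abelian group, `π : L →+ ℤ_p^d` SURJECTIVE, an «orbit»
family `o : ι → L` which GENERATES the functionals mod `p` (every `w : L →+ ℤ_p` divisible by `p` on the orbit is `p·w'`),
and `m < d` points `x : Fin m → L`: some functional is `≡ 0 (mod p)` on the `x_i` and `≢ 0` somewhere on the orbit.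
Linear algebra over `𝔽_p`: the `m` reductions of `π(x_i)` do not span `𝔽_p^d`, a non-zero `𝔽_p`-functional killing them lifts
through `π` to `w`; if `w` were `≡ 0` on the orbit, generation would make `w ≡ 0 (mod p)`, i.e. the functional zero (`π` onto).
[folklore] -/
private theorem exists_addMonoidHom_dvd_and_not_dvd_of_surjective {d m : ℕ} (hmd : m < d) (π : L →+ (Fin d → ℤ_[p]))
    (hπ : Function.Surjective π) {ι : Type*} (o : ι → L)
    (hgen : ∀ w : L →+ ℤ_[p], (∀ k, (p : ℤ_[p]) ∣ w (o k)) → ∃ w' : L →+ ℤ_[p], ∀ y, w y = (p : ℤ_[p]) * w' y)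
    (x : Fin m → L) :
    ∃ w : L →+ ℤ_[p], (∀ i, (p : ℤ_[p]) ∣ w (x i)) ∧ ∃ k, ¬ (p : ℤ_[p]) ∣ w (o k) := by
  have hp : p.Prime := Fact.out
  -- reduction mod `p` of vectors
  let red : (Fin d → ℤ_[p]) →+ (Fin d → ZMod p) :=
    { toFun := fun f t ↦ PadicInt.toZMod (f t)
      map_zero' := funext fun t ↦ by simp
      map_add' := fun f f' ↦ funext fun t ↦ by simp }
  have hred : ∀ f t, red f t = PadicInt.toZMod (f t) := fun f t ↦ rfl
  have hred_surj : ∀ v : Fin d → ZMod p, ∃ f : Fin d → ℤ_[p], red f = v := fun v ↦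
    ⟨fun t ↦ ((v t).val : ℤ_[p]), funext fun t ↦ by rw [hred, map_natCast, ZMod.natCast_zmod_val]⟩
  -- the span of the reductions of the `π (x i)` is a proper subspace
  set S : Submodule (ZMod p) (Fin d → ZMod p) := Submodule.span (ZMod p) (Set.range fun i ↦ red (π (x i))) with hS
  have hSlt : S < ⊤ := by
    refine Submodule.lt_top_of_finrank_lt_finrank ?_
    rw [Module.finrank_fin_fun]
    exact (finrank_range_le_card (R := ZMod p) fun i ↦ red (π (x i))).trans_lt (by rwa [Fintype.card_fin])
  obtain ⟨φ, hφ0, hφS⟩ := Submodule.exists_dual_map_eq_bot_of_lt_top hSlt inferInstance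
  have hφS' : ∀ v ∈ S, φ v = 0 := fun v hv ↦ by
    have : φ v ∈ S.map φ := Submodule.mem_map_of_mem hv
    rwa [hφS, Submodule.mem_bot] at this
  -- lift `φ` through `red`
  let φt : (Fin d → ℤ_[p]) →+ ℤ_[p] :=
    { toFun := fun f ↦ ∑ t, ((φ (Pi.single t 1)).val : ℤ_[p]) * f t
      map_zero' := by simp
      map_add' := fun f f' ↦ by rw [← sum_add_distrib]; exact sum_congr rfl fun t _ ↦ by rw [Pi.add_apply, mul_add] }
  have hφt : ∀ f, PadicInt.toZMod (φt f) = φ (red f) := by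
    intro f
    change PadicInt.toZMod (∑ t, ((φ (Pi.single t 1)).val : ℤ_[p]) * f t) = _
    rw [map_sum, pi_eq_sum_univ' (red f), map_sum]
    refine sum_congr rfl fun t _ ↦ ?_
    rw [map_mul, map_natCast, ZMod.natCast_zmod_val, map_smul, smul_eq_mul, mul_comm, hred]
  set w : L →+ ℤ_[p] := φt.comp π with hw
  have hw' : ∀ y, PadicInt.toZMod (w y) = φ (red (π y)) := fun y ↦ hφt (π y)
  refine ⟨w, fun i ↦ ?_, ?_⟩
  · rw [padicInt_dvd_iff_toZMod_eq_zero, hw']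
    exact hφS' _ (Submodule.subset_span ⟨i, rfl⟩)
  · by_contra hall
    push Not at hall
    obtain ⟨w', hww'⟩ := hgen w hall
    apply hφ0
    refine LinearMap.ext fun v ↦ ?_
    obtain ⟨f, hf⟩ := hred_surj v
    obtain ⟨y, hy⟩ := hπ f
    rw [LinearMap.zero_apply, ← hf, ← hy, ← hw', hww', map_mul, map_natCast, ZMod.natCast_self, zero_mul]

end Abstract

/-! ## §2 The Honda GENERATION clauses: a layer functional divisible by `p` on the orbit is divisible by `p` -/

section Local

universe u

variable {K : Type u} [Field K] {p : ℕ} [Fact p.Prime] (κ : ZpExtension K p)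
variable {E : Type u} [Field E] [Algebra K E] (ι : AlgebraicClosure K →ₐ[K] AlgebraicClosure E)
variable (W : WeierstrassCurve K)

open Literature.NumberTheory.EllipticCurves Literature.NumberTheory.GaloisRepresentations ZpExtension
  Literature.NumberTheory.EllipticCurves.Kobayashi2003 Literature.NumberTheory.EllipticCurves.Sprung2017

variable {κ ι W}

/-- **Generation (dual form of Sprung Thm. 2.2 / Cor. 2.10 «`c_n, c_{n−1}` generate `Ê(𝔪_n)` over `ℤ_p[G_n]`»).** For `n ≥ 1`,
a functional `w` on the layer `E(K_n·K_v)` whose values on the Honda orbit `{gʲc_n}`, `{gʲc_{n−1}}` are all divisible by `p` is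
`p` times a functional: the pairing sums `P_{n,c_n}(w)`, `P_{n,c_{n−1}}(w)` are `p·(A, B)`, the saturation clause of
`IsHondaSystem` gives `y` with `(A, B) ≡ (P_{n,c_n}(y), P_{n,c_{n−1}}(y)) (mod ω_n)`, and the injectivity clause kills `w − p·y`.
[cite: Sprung2012, Thm. 2.2 (p. 1487), Cor. 2.10 (p. 1489), Lemmas 7.4–7.5 (p. 1500)] -/
theorem exists_eq_mul_of_dvd_evalOn_orbit {ap : ℤ} {g : Field.absoluteGaloisGroup E} {cneg : localPoints W E}
    {c : ℕ → localPoints W E} (hH : IsHondaSystem κ ι W ap g cneg c) {n : ℕ} (hn : 1 ≤ n)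
    (w : localLayerPointsOfEmb κ ι W n →+ ℤ_[p])
    (hcn : ∀ j : ℕ, (p : ℤ_[p]) ∣ evalOn W (localLayerPointsOfEmb κ ι W n) w (g ^ j • c n))
    (hcn1 : ∀ j : ℕ, (p : ℤ_[p]) ∣ evalOn W (localLayerPointsOfEmb κ ι W n) w (g ^ j • c (n - 1))) :
    ∃ w' : localLayerPointsOfEmb κ ι W n →+ ℤ_[p], ∀ y, w y = (p : ℤ_[p]) * w' y := by
  obtain ⟨-, -, -, -, -, -, -, hinj, hsat⟩ := hH
  choose a ha using hcn
  choose b hb using hcn1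
  set A : IwasawaAlgebra p := ∑ j ∈ range (p ^ n), PowerSeries.C (a j) * (1 + PowerSeries.X) ^ j with hA
  set B : IwasawaAlgebra p := ∑ j ∈ range (p ^ n), PowerSeries.C (b j) * (1 + PowerSeries.X) ^ j with hB
  have hPA : pairingSum W (localLayerPointsOfEmb κ ι W n) g n (c n) w = PowerSeries.C (p : ℤ_[p]) * A := by
    rw [pairingSum_def, hA, mul_sum]
    exact sum_congr rfl fun j _ ↦ by rw [ha j, map_mul, mul_assoc]
  have hPB : pairingSum W (localLayerPointsOfEmb κ ι W n) g n (c (n - 1)) w = PowerSeries.C (p : ℤ_[p]) * B := by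
    rw [pairingSum_def, hB, mul_sum]
    exact sum_congr rfl fun j _ ↦ by rw [hb j, map_mul, mul_assoc]
  obtain ⟨y, hyA, hyB⟩ := hsat n hn A B ⟨w, by rw [hPA, sub_self]; exact dvd_zero _, by rw [hPB, sub_self]; exact dvd_zero _⟩
  have hzero : w - (p : ℤ_[p]) • y = 0 := by
    refine hinj n hn _ ?_ ?_
    · rw [pairingSum_sub, pairingSum_smul, hPA, ← mul_sub]
      exact dvd_mul_of_dvd_right hyA _
    · rw [pairingSum_sub, pairingSum_smul, hPB, ← mul_sub]
      exact dvd_mul_of_dvd_right hyB _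
  refine ⟨y, fun x ↦ ?_⟩
  have h := congrArg (fun f : localLayerPointsOfEmb κ ι W n →+ ℤ_[p] ↦ f x) hzero
  simp only [AddMonoidHom.sub_apply, AddMonoidHom.smul_apply, smul_eq_mul, AddMonoidHom.zero_apply, sub_eq_zero] at h
  exact h

/-- **(RANK₂) from a surjection `E(K_2·K_v) ↠ ℤ_p^{p²}` and generation**: for every family of `p² − 1` points of the layer,
some functional `E(K_2·K_v) →+ ℤ_p` is `≡ 0 (mod p)` on the family and `≢ 0` at some Honda orbit point `gʲc_2` or `gʲc_1` —
the hypothesis `hrank` of `honda_independent_of_rank` / `forall_exists_isColemanPair_X_mul_of_rank`.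
[cite: Sprung2012, Thm. 2.2 and Lemma 2.3 (p. 1487), Cor. 2.10 (p. 1489)] -/
theorem honda_rank_of_surjective {ap : ℤ} {g : Field.absoluteGaloisGroup E} {cneg : localPoints W E}
    {c : ℕ → localPoints W E} (hH : IsHondaSystem κ ι W ap g cneg c)
    (π : localLayerPointsOfEmb κ ι W 2 →+ (Fin (p ^ 2) → ℤ_[p])) (hπ : Function.Surjective π) :
    ∀ x : Fin (p ^ 2 - 1) → localPoints W E, (∀ i, x i ∈ localLayerPointsOfEmb κ ι W 2) →
      ∃ w : localLayerPointsOfEmb κ ι W 2 →+ ℤ_[p],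
        (∀ i, (p : ℤ_[p]) ∣ evalOn W (localLayerPointsOfEmb κ ι W 2) w (x i)) ∧
        ((∃ j : ℕ, ¬ (p : ℤ_[p]) ∣ evalOn W (localLayerPointsOfEmb κ ι W 2) w (g ^ j • c 2)) ∨
          ∃ j : ℕ, ¬ (p : ℤ_[p]) ∣ evalOn W (localLayerPointsOfEmb κ ι W 2) w (g ^ j • c 1)) := by
  intro x hx
  have hp : p.Prime := Fact.out
  have hc2 : ∀ j : ℕ, g ^ j • c 2 ∈ localLayerPointsOfEmb κ ι W 2 := fun j ↦ smul_mem_localLayerPointsOfEmb κ ι W 2 _ (hH.2.1 2)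
  have hc1 : ∀ j : ℕ, g ^ j • c 1 ∈ localLayerPointsOfEmb κ ι W 2 := fun j ↦
    smul_mem_localLayerPointsOfEmb κ ι W 2 _ (localLayerPointsOfEmb_mono κ ι W (by norm_num : 1 ≤ 2) (hH.2.1 1))
  -- the orbit family, indexed by `ℕ ⊕ ℕ`
  let o : ℕ ⊕ ℕ → localLayerPointsOfEmb κ ι W 2 := fun k ↦ Sum.elim (fun j ↦ ⟨g ^ j • c 2, hc2 j⟩) (fun j ↦ ⟨g ^ j • c 1, hc1 j⟩) k
  have hgen : ∀ w : localLayerPointsOfEmb κ ι W 2 →+ ℤ_[p], (∀ k, (p : ℤ_[p]) ∣ w (o k)) →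
      ∃ w' : localLayerPointsOfEmb κ ι W 2 →+ ℤ_[p], ∀ y, w y = (p : ℤ_[p]) * w' y := by
    intro w hw
    refine exists_eq_mul_of_dvd_evalOn_orbit hH (by norm_num : 1 ≤ 2) w (fun j ↦ ?_) (fun j ↦ ?_)
    · rw [evalOn_of_mem W _ w (hc2 j)]
      exact hw (Sum.inl j)
    · rw [evalOn_of_mem W _ w (hc1 j)]
      exact hw (Sum.inr j)
  have hlt : p ^ 2 - 1 < p ^ 2 := Nat.sub_lt (pow_pos hp.pos 2) Nat.one_pos
  obtain ⟨w, hwx, k, hk⟩ := exists_addMonoidHom_dvd_and_not_dvd_of_surjective hlt π hπ o hgen (fun i ↦ ⟨x i, hx i⟩)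
  refine ⟨w, fun i ↦ by rw [evalOn_of_mem W _ w (hx i)]; exact hwx i, ?_⟩
  rcases k with j | j
  · exact Or.inl ⟨j, by rw [evalOn_of_mem W _ w (hc2 j)]; exact hk⟩
  · exact Or.inr ⟨j, by rw [evalOn_of_mem W _ w (hc1 j)]; exact hk⟩

/-- **`T·Λ² ⊆ Col(H¹_Iw(T))` from a surjection `E(K_2·K_v) ↠ ℤ_p^{p²}`** (any base; `p ∣ a_p`, Honda system, `p`-torsion-free
tower, `c_{−1} ∉ p·E(K_2·K_v)`). [cite: Sprung2012, Thm. 2.2, Lemma 2.3 (p. 1487), Def. 5.9 (p. 1495), §7.1 (pp. 1500–1501)]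
[cite: KuriharaPollack2007, Prop. 1.2] [cite: LeiSujatha2021, §3 (SES-KP)] -/
theorem forall_exists_isColemanPair_X_mul_of_surjective {ap : ℤ} (hap : (p : ℤ) ∣ ap) {g : Field.absoluteGaloisGroup E}
    (hg : κ.IsTopGenerator (resGalOfEmb ι g)) {cneg : localPoints W E} {c : ℕ → localPoints W E}
    (hH : IsHondaSystem κ ι W ap g cneg c)
    (hN : ∀ P : localPoints W E, P ∈ localTowerPointsOfEmb κ ι W → p • P = 0 → P = 0)
    (hcneg : ∀ (m : ℤ) (y : localPoints W E), y ∈ localLayerPointsOfEmb κ ι W 2 → p • y = m • cneg → (p : ℤ) ∣ m)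
    (π : localLayerPointsOfEmb κ ι W 2 →+ (Fin (p ^ 2) → ℤ_[p])) (hπ : Function.Surjective π) :
    ∀ x y : IwasawaAlgebra p, ∃ z : localTowerPointsOfEmb κ ι W →+ ℤ_[p],
      IsColemanPair κ ι W ap g c z (PowerSeries.X * x) (PowerSeries.X * y) :=
  forall_exists_isColemanPair_X_mul_of_rank hap hg hH hN hcneg (honda_rank_of_surjective hH π hπ)

end Local

/-! ## §3 Over `ℚ`: the joint Coleman map with cokernel `Λ/(T)` modulo ONE surjection `E(ℚ_{p,2}) ↠ ℤ_p^{p²}` -/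

section Rat

open NumberField IsDedekindDomain Literature.NumberTheory.EllipticCurves Literature.NumberTheory.GaloisRepresentations
  ZpExtension Literature.NumberTheory.EllipticCurves.Kobayashi2003 Literature.NumberTheory.EllipticCurves.Sprung2017

/-- **(SES-KP) over `ℚ` modulo «`E(ℚ_{p,2})` has `ℤ_p`-rank `≥ p²`».** `W/ℚ` elliptic globally minimal, `p ≠ 2` good
supersingular, any `ℤ_p`-extension `κ`, `v ∋ p`, the chosen embedding, `g` a local lift of the topological generator, `(c_{−1}, c)`
a Honda system, and ANY surjective additive map `π : E(ℚ_p·ℚ_2) ↠ ℤ_p^{p²}` (the formal group `Ê(ℚ_{p,2}) ⊆ E(ℚ_{p,2})` of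
finite prime-to-`p` index is `ℤ_p`-free of rank `[ℚ_{p,2} : ℚ_p] = p²`: Silverman AEC IV.6.4 / VII.6.3, Sprung Lemma 2.3): the
joint Coleman map is an INJECTIVE `Λ`-linear `J : H¹_Iw(T) → Λ × Λ` with `Col(z) = J z`, `T·Λ² ⊆ range J`, and
`ℓ_𝔭(Λ²/range J) = 0` at every prime `𝔭 ∌ T` — the hypotheses `J`/`hJ`/`hcoker` of the F-α skeleton
`min_lengthAt_quotient_range_le_lengthAt_torsion_of_skeleton`.
[cite: Sprung2012, Thm. 2.2, Lemma 2.3 (p. 1487), Def. 5.9 (p. 1495), Def. 7.1–7.2, Props. 7.3/7.6 (pp. 1500–1501)]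
[cite: KuriharaPollack2007, Prop. 1.2] [cite: LeiSujatha2021, §3 (SES-KP)] -/
theorem exists_linearMap_isColemanPair_cokernel_of_surjective_rat (W : WeierstrassCurve ℚ) [W.IsElliptic]
    [W.IsGloballyMinimal] (p : ℕ) [Fact p.Prime] (hp2 : p ≠ 2) (hgood : W.HasGoodReductionAtPrime p)
    (hap : (p : ℤ) ∣ W.frobeniusTrace p) (κ : ZpExtension ℚ p) {v : HeightOneSpectrum (𝓞 ℚ)} (hpv : (p : 𝓞 ℚ) ∈ v.asIdeal)
    {g : Field.absoluteGaloisGroup (v.adicCompletion ℚ)}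
    (hg : κ.IsTopGenerator (resGalOfEmb (closureEmb (K := ℚ) (v.adicCompletion ℚ)) g))
    {cneg : localPoints W (v.adicCompletion ℚ)} {c : ℕ → localPoints W (v.adicCompletion ℚ)}
    (hH : IsHondaSystem κ (closureEmb (K := ℚ) (v.adicCompletion ℚ)) W (W.frobeniusTrace p) g cneg c)
    (π : localLayerPointsOfEmb κ (closureEmb (K := ℚ) (v.adicCompletion ℚ)) W 2 →+ (Fin (p ^ 2) → ℤ_[p]))
    (hπ : Function.Surjective π) :
    letI := moduleOfGenerator κ (closureEmb (K := ℚ) (v.adicCompletion ℚ)) W hg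
    ∃ J : (localTowerPointsOfEmb κ (closureEmb (K := ℚ) (v.adicCompletion ℚ)) W →+ ℤ_[p]) →ₗ[IwasawaAlgebra p]
        IwasawaAlgebra p × IwasawaAlgebra p,
      (∀ z, IsColemanPair κ (closureEmb (K := ℚ) (v.adicCompletion ℚ)) W (W.frobeniusTrace p) g c z (J z).1 (J z).2) ∧
      Function.Injective J ∧
      (∀ x y : IwasawaAlgebra p, ∃ z, J z = (PowerSeries.X * x, PowerSeries.X * y)) ∧
      ∀ 𝔭 : PrimeSpectrum (IwasawaAlgebra p), (PowerSeries.X : IwasawaAlgebra p) ∉ 𝔭.asIdeal →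
        Module.lengthAt (IwasawaAlgebra p) ((IwasawaAlgebra p × IwasawaAlgebra p) ⧸ LinearMap.range J) 𝔭 = 0 :=
  exists_linearMap_isColemanPair_cokernel_of_rank_rat W p hp2 hgood hap κ hpv hg hH (honda_rank_of_surjective hH π hπ)

end Rat

end Literature.NumberTheory.EllipticCurves.Sprung2012

end
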